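import Mathlib
import Summits.Ventures.PercRepro2.Defs
import Summits.Ventures.PercRepro2.Independence
import Summits.Ventures.PercRepro2.Harris
import Summits.Ventures.PercRepro2.Graph
import Summits.Ventures.PercRepro2.Events
import Summits.Ventures.PercRepro2.ZCK4

/-!
# (ZC) on an embedded `K₄` — transport along a graph embedding (blind cell PercRepro2, mine-a g27)

If a graph `(V, E, ends)` carries six edges `φ 0, …, φ 5` forming a `K₄` on four vertices `ι 0, …, ι 3`
and every other edge has weight `0`, then its (ZC) expression for the marks `ι 0, ι 1, ι 2` equals the
(ZC) expression of `K₄` under the weights `p ∘ φ` and the pulled-back up-set `{S | ι '' S ∈ 𝓔}`, so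
`zc_k4` applies: **(ZC) holds for every weight vector supported on an embedded `K₄` and every cluster
up-set** (`zc_k4_embed`).  This is the base case that makes `K₄` usable at the end of a dismantling
(`zc_of_dismantling₆`), covers every placement of the marks on `K₄` (a permutation of `Fin 4`), and every
simple graph on at most four vertices.

The transport: a configuration `ω'` of the six `K₄` edges is extended by closed edges (`embedConfig`);
configurations open somewhere off the image have weight `0`, so `prob p A = prob (p ∘ φ) (embedConfig ⁻¹' A)`;
connections and clusters of the embedded vertices correspond (the closure lemma `mem_of_conn_of_closed`
with the image of the `K₄` cluster as the closed set).
-/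

namespace Summit.Ventures.PercRepro2

section Embed

variable {V : Type*} {E : Type*} [DecidableEq E]

/-- Extend a configuration of the six `K₄` edges to `E`: open exactly at the edges `φ i` with `ω' i = true`. -/
def embedConfig (φ : Fin 6 → E) (ω' : Config (Fin 6)) : Config E :=
  fun e => decide (∃ i, φ i = e ∧ ω' i = true)

/-- The extended configuration at an image edge. -/
lemma embedConfig_apply {φ : Fin 6 → E} (hφ : Function.Injective φ) (ω' : Config (Fin 6)) (i : Fin 6) :
    embedConfig φ ω' (φ i) = ω' i := by
  unfold embedConfig
  cases h : ω' i
  · simp only [decide_eq_false_iff_not, not_exists, not_and]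
    intro j hj
    rw [hφ hj, h]
    simp
  · simp only [decide_eq_true_eq]
    exact ⟨i, rfl, h⟩

/-- The extended configuration is closed off the image. -/
lemma embedConfig_apply_of_not {φ : Fin 6 → E} (ω' : Config (Fin 6)) {e : E} (he : ∀ i, φ i ≠ e) :
    embedConfig φ ω' e = false := by
  unfold embedConfig
  simp only [decide_eq_false_iff_not, not_exists, not_and]
  intro i hi
  exact absurd hi (he i)

/-- An open edge of the extended configuration is an open image edge. -/
lemma exists_of_embedConfig_eq_true {φ : Fin 6 → E} {ω' : Config (Fin 6)} {e : E}
    (h : embedConfig φ ω' e = true) : ∃ i, φ i = e ∧ ω' i = true := by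
  unfold embedConfig at h
  simpa using h

/-- A configuration closed off the image is the extension of its restriction. -/
lemma embedConfig_restrict {φ : Fin 6 → E} (hφ : Function.Injective φ) (ω : Config E)
    (hω : ∀ e, (∀ i, φ i ≠ e) → ω e = false) : embedConfig φ (fun i => ω (φ i)) = ω := by
  funext e
  by_cases he : ∃ i, φ i = e
  · obtain ⟨i, rfl⟩ := he
    exact embedConfig_apply hφ _ i
  · push Not at he
    rw [embedConfig_apply_of_not _ he, hω e he]

/-- `embedConfig` is injective. -/
lemma embedConfig_injective {φ : Fin 6 → E} (hφ : Function.Injective φ) :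
    Function.Injective (embedConfig φ) := by
  intro ω₁ ω₂ h
  funext i
  have := congrFun h (φ i)
  rwa [embedConfig_apply hφ, embedConfig_apply hφ] at this

variable [Fintype E] {R : Type*} [CommRing R]

/-- The weight of an extended configuration is the `K₄` weight, when the other edges have weight `0`. -/
lemma weight_embedConfig {φ : Fin 6 → E} (hφ : Function.Injective φ) {p : E → R}
    (hzero : ∀ e, (∀ i, φ i ≠ e) → p e = 0) (ω' : Config (Fin 6)) :
    weight p (embedConfig φ ω') = weight (p ∘ φ) ω' := by
  unfold weight
  rw [← Finset.prod_subset (Finset.subset_univ (Finset.univ.image φ))]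
  · rw [Finset.prod_image (fun i _ j _ h => hφ h)]
    refine Finset.prod_congr rfl fun i _ => ?_
    rw [embedConfig_apply hφ]
    rfl
  · intro e _ he
    have he' : ∀ i, φ i ≠ e := by
      intro i hi
      exact he (Finset.mem_image.2 ⟨i, Finset.mem_univ i, hi⟩)
    rw [embedConfig_apply_of_not _ he', hzero e he']
    simp

omit [DecidableEq E] in
/-- A configuration open somewhere off the image has weight `0`. -/
lemma weight_eq_zero_of_open_off {φ : Fin 6 → E} {p : E → R}
    (hzero : ∀ e, (∀ i, φ i ≠ e) → p e = 0) {ω : Config E} {e : E} (he : ∀ i, φ i ≠ e)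
    (hω : ω e = true) : weight p ω = 0 := by
  unfold weight
  refine Finset.prod_eq_zero (Finset.mem_univ e) ?_
  rw [hω, hzero e he]
  rfl

/-- **Transport of probabilities**: with the weights supported on the six image edges, the probability of
an event is the `K₄` probability of its pull-back. -/
lemma prob_eq_prob_embed {φ : Fin 6 → E} (hφ : Function.Injective φ) {p : E → R}
    (hzero : ∀ e, (∀ i, φ i ≠ e) → p e = 0) (A : Set (Config E)) :
    prob p A = prob (p ∘ φ) (embedConfig φ ⁻¹' A) := by
  classical
  unfold prob
  rw [← Finset.sum_subset (Finset.subset_univ (Finset.univ.image (embedConfig φ)))]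
  · rw [Finset.sum_image (fun a _ b _ h => embedConfig_injective hφ h)]
    refine Finset.sum_congr rfl fun ω' _ => ?_
    rw [← Set.indicator_comp_right (embedConfig φ) (g := weight p)]
    refine congrArg (fun f => Set.indicator (embedConfig φ ⁻¹' A) f ω') ?_
    funext ω''
    exact weight_embedConfig hφ hzero ω''
  · intro ω _ hω
    by_cases hcl : ∀ e, (∀ i, φ i ≠ e) → ω e = false
    · exact absurd (Finset.mem_image.2 ⟨_, Finset.mem_univ _, embedConfig_restrict hφ ω hcl⟩) hω
    · push Not at hcl
      obtain ⟨e, he, hωe⟩ := hcl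
      simp only [Bool.not_eq_false] at hωe
      rw [Set.indicator_apply]
      split_ifs
      · exact weight_eq_zero_of_open_off hzero he hωe
      · rfl

end Embed

section Graph

variable {V : Type*} {E : Type*} [DecidableEq E] {ends : E → Sym2 V} {ends₀ : Fin 6 → Sym2 (Fin 4)}
  {ι : Fin 4 → V} {φ : Fin 6 → E}

/-- Open adjacency in the small graph gives open adjacency in the embedded graph. -/
lemma openAdj_embed (hφends : ∀ i, ends (φ i) = (ends₀ i).map ι) {ω' : Config (Fin 6)}
    (hφ : Function.Injective φ) {a b : Fin 4} (h : OpenAdj ends₀ ω' a b) :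
    OpenAdj ends (embedConfig φ ω') (ι a) (ι b) := by
  obtain ⟨i, hi, hab⟩ := h
  refine ⟨φ i, ?_, ?_⟩
  · rw [embedConfig_apply hφ, hi]
  · rw [hφends, hab, Sym2.map_mk]

/-- Connection in the small graph gives connection in the embedded graph. -/
lemma conn_embed_of_conn (hφends : ∀ i, ends (φ i) = (ends₀ i).map ι) (hι : Function.Injective ι)
    (hφ : Function.Injective φ) {ω' : Config (Fin 6)} {a b : Fin 4} (h : Conn ends₀ ω' a b) :
    Conn ends (embedConfig φ ω') (ι a) (ι b) := by
  let f : openGraph ends₀ ω' →g openGraph ends (embedConfig φ ω') :=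
    ⟨ι, fun {x y} hxy => by
      rw [openGraph_adj] at hxy ⊢
      exact ⟨fun h => hxy.1 (hι h), openAdj_embed hφends hφ hxy.2⟩⟩
  exact SimpleGraph.Reachable.map f h

/-- The image of a cluster of the small graph is closed under open adjacency in the embedded graph. -/
lemma image_cluster_closed (hφends : ∀ i, ends (φ i) = (ends₀ i).map ι) (hι : Function.Injective ι)
    (ω' : Config (Fin 6)) (u : Fin 4) :
    ∀ x ∈ ι '' cluster ends₀ ω' u, ∀ y, (openGraph ends (embedConfig φ ω')).Adj x y →
      y ∈ ι '' cluster ends₀ ω' u := by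
  rintro x ⟨a, ha, rfl⟩ y hxy
  rw [openGraph_adj] at hxy
  obtain ⟨_, e, he, hends⟩ := hxy
  obtain ⟨i, rfl, hi⟩ := exists_of_embedConfig_eq_true he
  rw [hφends] at hends
  induction hk : ends₀ i using Sym2.ind with
  | h c d =>
    rw [hk, Sym2.map_mk, Sym2.eq_iff] at hends
    rcases hends with ⟨hca, hdy⟩ | ⟨hcy, hda⟩
    · refine ⟨d, ?_, hdy⟩
      exact mem_cluster.2 (conn_trans (mem_cluster.1 ha) (conn_of_openAdj ⟨i, hi, by rw [hk, hι hca]⟩))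
    · refine ⟨c, ?_, hcy⟩
      exact mem_cluster.2 (conn_trans (mem_cluster.1 ha)
        (conn_of_openAdj ⟨i, hi, by rw [hk, hι hda, Sym2.eq_swap]⟩))

/-- **Transport of clusters**: the cluster of an embedded vertex is the image of its cluster in the small graph. -/
lemma cluster_embed (hφends : ∀ i, ends (φ i) = (ends₀ i).map ι) (hι : Function.Injective ι)
    (hφ : Function.Injective φ) (ω' : Config (Fin 6)) (u : Fin 4) :
    cluster ends (embedConfig φ ω') (ι u) = ι '' cluster ends₀ ω' u := by
  ext y
  constructor
  · intro hy
    exact mem_of_conn_of_closed (image_cluster_closed hφends hι ω' u)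
      ⟨u, mem_cluster_self _ _ _, rfl⟩ (mem_cluster.1 hy)
  · rintro ⟨a, ha, rfl⟩
    exact mem_cluster.2 (conn_embed_of_conn hφends hι hφ (mem_cluster.1 ha))

/-- **Transport of connections**. -/
lemma conn_embed_iff (hφends : ∀ i, ends (φ i) = (ends₀ i).map ι) (hι : Function.Injective ι)
    (hφ : Function.Injective φ) (ω' : Config (Fin 6)) (u v : Fin 4) :
    Conn ends (embedConfig φ ω') (ι u) (ι v) ↔ Conn ends₀ ω' u v := by
  constructor
  · intro h
    have : ι v ∈ cluster ends (embedConfig φ ω') (ι u) := mem_cluster.2 h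
    rw [cluster_embed hφends hι hφ] at this
    obtain ⟨w, hw, hwv⟩ := this
    rw [hι hwv] at hw
    exact mem_cluster.1 hw
  · exact conn_embed_of_conn hφends hι hφ

/-- The pull-back of a connection event of embedded vertices. -/
lemma preimage_connEvent_embed (hφends : ∀ i, ends (φ i) = (ends₀ i).map ι)
    (hι : Function.Injective ι) (hφ : Function.Injective φ) (u v : Fin 4) :
    embedConfig φ ⁻¹' connEvent ends (ι u) (ι v) = connEvent ends₀ u v := by
  ext ω'
  simp only [Set.mem_preimage, mem_connEvent]
  exact conn_embed_iff hφends hι hφ ω' u v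

/-- The pull-back of the up-set event of an embedded vertex. -/
lemma preimage_clusterInEvent_embed (hφends : ∀ i, ends (φ i) = (ends₀ i).map ι)
    (hι : Function.Injective ι) (hφ : Function.Injective φ) (u : Fin 4) (𝓔 : Set (Set V)) :
    embedConfig φ ⁻¹' clusterInEvent ends (ι u) 𝓔 = clusterInEvent ends₀ u {S | ι '' S ∈ 𝓔} := by
  ext ω'
  simp only [Set.mem_preimage, mem_clusterInEvent, Set.mem_setOf_eq]
  rw [cluster_embed hφends hι hφ]

/-- The pulled-back up-set is an up-set. -/
lemma isUpperSet_image_preimage {𝓔 : Set (Set V)} (h𝓔 : IsUpperSet 𝓔) :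
    IsUpperSet {S : Set (Fin 4) | ι '' S ∈ 𝓔} :=
  fun _ _ hST hS => h𝓔 (Set.image_mono hST) hS

end Graph

/-- **(ZC) on an embedded `K₄`**: if the six edges `φ 0, …, φ 5` of `(V, E, ends)` form a `K₄` on the
distinct vertices `ι 0, …, ι 3` (`ends (φ i) = (ends₀ i).map ι`) and every other edge has weight `0`,
then (ZC) holds for the marks `a₁ = ι 0`, `a₃ = ι 1`, `o = ι 2`, every weight vector and every cluster
up-set. -/
theorem zc_k4_embed {R : Type*} [CommRing R] [LinearOrder R] [IsStrictOrderedRing R]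
    {V : Type*} {E : Type*} [Fintype E] [DecidableEq E] {ends : E → Sym2 V} {p : E → R}
    (hp : IsProbVec p) {ι : Fin 4 → V} (hι : Function.Injective ι) {φ : Fin 6 → E}
    (hφ : Function.Injective φ)
    (hφends : ∀ i, ends (φ i) = ((![s(0, 1), s(0, 2), s(0, 3), s(1, 2), s(1, 3), s(2, 3)] :
      Fin 6 → Sym2 (Fin 4)) i).map ι)
    (hzero : ∀ e, (∀ i, φ i ≠ e) → p e = 0) {𝓔 : Set (Set V)} (h𝓔 : IsUpperSet 𝓔) :
    let e := connEvent ends (ι 0) (ι 1)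
    let L' := connEvent ends (ι 0) (ι 2)
    let U := clusterInEvent ends (ι 0) 𝓔
    let γ := connEvent ends (ι 1) (ι 2)
    0 ≤ prob p (eᶜ ∩ L'ᶜ ∩ γᶜ) * (prob p (U ∩ (e ∩ L')) - prob p U * prob p (e ∩ L'))
      - prob p (eᶜ ∩ L'ᶜ ∩ γ) * (prob p (U ∩ (e ∩ L'ᶜ)) - prob p U * prob p (e ∩ L'ᶜ)) := by
  intro e L' U γ
  have hp' : IsProbVec (p ∘ φ) := ⟨fun i => hp.nonneg (φ i), fun i => hp.le_one (φ i)⟩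
  have h := zc_k4 hp' (isUpperSet_image_preimage (ι := ι) h𝓔)
  simp only at h
  simp only [e, L', U, γ, prob_eq_prob_embed hφ hzero, Set.preimage_inter, Set.preimage_compl,
    preimage_connEvent_embed hφends hι hφ, preimage_clusterInEvent_embed hφends hι hφ]
  exact h

end Summit.Ventures.PercRepro2
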